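import Literature.Probability.Percolation.SiteInterfaceWindingSigns
import Literature.Probability.Percolation.LoopTraversalBound
import Literature.Topology.PlaneTopology.WindingNumberCrossing
import HarnessLib

/-!
# Winding numbers of interface loops at all points off the trace

Topic `Literature/Probability/Percolation` (proofs only; no definitions, no named facts).
Companion to `SiteInterfaceWinding.lean` (the jump of the winding number across a crossed edge)
and `SiteInterfaceWindingSigns.lean` (one-signedness at the lattice sites; the DKKMO type of an
interface loop is the sign of its site winding numbers), towards the typed comparison of
lattice and continuum loops in the `d_CN` form of the Camia–Newman full-plane loop law
(`FullPlaneCNL.lean`, named fact `exists_isFullPlaneCNLLaw`): there the winding number of a loop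
about an *arbitrary* point of the plane (not only a mesh point) is what survives a sup-norm
perturbation of the loop. This file extends the site statements to all points off the trace:

* `IsSiteInterfaceLoop.exists_site_loopWind_eq` — **the winding number of an interface loop at
  any point off its trace equals its winding number at some lattice site.** No Jordan curve
  theorem and no cell decomposition is used: follow a generic ray from `p` (`exists_good_slope`:
  through no vertex, parallel to no piece). Either it never meets the trace — then `p` is joined
  off the trace to points farther than the trace, where the winding number vanishes as at all
  far sites — or it first meets the trace at an interior point `q` of a piece, from a definite
  side. Near a compact sub-segment `K` of that open piece through `q` and the midpoint `M`, the
  trace is the straight piece alone (distinct pieces of the cycle meet only at common vertices,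
  `eq_polyPt_of_mem_polyPiece_of_ne`, so the other pieces keep a positive distance from `K`),
  hence the two open side regions near `K` are convex and trace-free, and the winding number is
  constant on each; each contains the germ at `M` of one half of the side segment — the crossed
  edge of `δ𝕋`, which meets the trace only at `M` (`eq_midpoint_of_mem_sideSeg_of_mem_polyTrace`)
  and bisects the piece (`midpoint_polyPt_eq`) — whose far end is the left (open) or the right
  (closed) site of the step (`loopWind_midpoint_add_smul`).
* Consequences with `SiteInterfaceWindingSigns.lean`:
  `loopWind_eq_zero_or_one_of_shoelace_pos_of_not_mem` (a loop of DKKMO type `1` winds `0` or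
  `1` about every point off its trace), `loopWind_eq_zero_or_neg_one_of_shoelace_nonpos_of_not_mem`
  (type `0`: `0` or `-1`), `abs_loopWind_le_one_of_not_mem`.
* Plane-geometry helpers: the side functional `segSide A B` is affine (`segSide_add`,
  `segSide_convex_comb`; open sides are convex), and a point of the line near the midpoint lies
  on the segment (`mem_segment_of_segSide_eq_zero_of_dist_midpoint_lt`).

## References

* F. Camia, C. M. Newman, Comm. Math. Phys. 268 (2006) 1–38, §4 and §5.2 [CamiaNewman2006].
* L. V. Ahlfors, *Complex Analysis*, 3rd ed. (1979), §4.2.1 (winding numbers; constancy on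
  components of the complement).
-/

noncomputable section

open Set Metric Complex

namespace Literature.Probability.Percolation

open LatticeModels Literature.Topology.PlaneTopology

/-! ### The side functional of a line is affine -/

/-- **The side functional is affine**: translating the point by `v` changes `segSide A B` by the
cross product of `B - A` and `v`, independently of the point. [folklore] -/
theorem segSide_add (A B q v : ℂ) :
    segSide A B (q + v) = segSide A B q + ((B - A).im * v.re - (B - A).re * v.im) := by
  rw [segSide_eq, segSide_eq]
  simp only [Complex.add_re, Complex.add_im, Complex.sub_re, Complex.sub_im]
  ring

/-- The side functional along the ray `q + s v` from a point `q` of the line. [folklore] -/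
theorem segSide_add_smul {A B q : ℂ} (hq : segSide A B q = 0) (v : ℂ) (s : ℝ) :
    segSide A B (q + (s : ℂ) * v) = s * ((B - A).im * v.re - (B - A).re * v.im) := by
  rw [segSide_add, hq, zero_add]
  simp only [Complex.mul_re, Complex.mul_im, Complex.ofReal_re, Complex.ofReal_im, zero_mul, sub_zero, add_zero]
  ring

/-- The side functional of a convex combination. [folklore] -/
theorem segSide_convex_comb (A B x y : ℂ) {a b : ℝ} (hab : a + b = 1) :
    segSide A B (a • x + b • y) = a * segSide A B x + b * segSide A B y := by
  rw [segSide_eq, segSide_eq, segSide_eq]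
  simp only [Complex.add_re, Complex.add_im, Complex.smul_re, Complex.smul_im, smul_eq_mul]
  have hb : b = 1 - a := by linarith
  subst hb
  ring

/-- The open positive side of a line is convex. [folklore] -/
theorem convex_setOf_segSide_pos (A B : ℂ) : Convex ℝ {z : ℂ | 0 < segSide A B z} := by
  intro x hx y hy a b ha hb hab
  simp only [mem_setOf_eq] at hx hy ⊢
  rw [segSide_convex_comb A B x y hab]
  rcases ha.eq_or_lt with rfl | ha'
  · rw [zero_add] at hab; subst hab; simpa using hy
  · nlinarith [mul_nonneg hb hy.le]

/-- The open negative side of a line is convex. [folklore] -/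
theorem convex_setOf_segSide_neg (A B : ℂ) : Convex ℝ {z : ℂ | segSide A B z < 0} := by
  intro x hx y hy a b ha hb hab
  simp only [mem_setOf_eq] at hx hy ⊢
  rw [segSide_convex_comb A B x y hab]
  rcases ha.eq_or_lt with rfl | ha'
  · rw [zero_add] at hab; subst hab; simpa using hy
  · nlinarith [mul_nonpos_iff.2 (Or.inl ⟨hb, hy.le⟩)]

/-- A point of the line `AB` (side `0`) within `dist A B / 2` of the midpoint lies on the closed
segment `[A, B]`. [folklore] -/
theorem mem_segment_of_segSide_eq_zero_of_dist_midpoint_lt {A B z : ℂ} (hAB : A ≠ B) (hz : segSide A B z = 0)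
    (hd : dist z (midpoint ℝ A B) < dist A B / 2) : z ∈ segment ℝ A B := by
  obtain ⟨μ, rfl⟩ := exists_eq_lineMap_of_segSide_eq_zero hAB hz
  have hAB' : 0 < dist A B := dist_pos.2 hAB
  have hmid : midpoint ℝ A B = AffineMap.lineMap A B (2⁻¹ : ℝ) := by
    rw [midpoint, invOf_eq_inv]
  rw [hmid, dist_lineMap_lineMap, Real.dist_eq] at hd
  have h1 : |μ - 2⁻¹| < 2⁻¹ := by
    by_contra h
    push Not at h
    nlinarith
  rw [abs_lt] at h1
  rw [segment_eq_image_lineMap]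
  exact ⟨μ, ⟨by linarith, by linarith⟩, rfl⟩

/-! ### Pieces and side segments of an interface loop -/

section Pieces

variable {ω : SiteConfig (Site 2)} {f₀ : HexVertex} {w : hexGraph.Walk f₀ f₀}
  (hw : IsSiteInterfaceLoop ω w) {δ : ℝ} (hδ : 0 < δ)

omit hw in
/-- The polygon closes up: the last vertex is the first. [folklore] -/
theorem polyPt_length_eq_polyPt_zero (δ : ℝ) (w : hexGraph.Walk f₀ f₀) : polyPt δ w w.length = polyPt δ w 0 := by
  rw [polyPt, polyPt, SimpleGraph.Walk.getVert_length, SimpleGraph.Walk.getVert_zero]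

include hw

/-- **The midpoint of a piece is the midpoint of its side segment** (the crossed edge of `δ𝕋` and
the dual edge bisect each other, `midpoint_hexCenter_oppFace`). [folklore] -/
theorem IsSiteInterfaceLoop.midpoint_polyPt_eq {i : ℕ} (hi : i < w.length) :
    midpoint ℝ (polyPt δ w i) (polyPt δ w (i + 1)) = midpoint ℝ (hw.leftPt δ i) (hw.rightPt δ i) := by
  rw [polyPt, polyPt, ← mul_midpoint, hw.getVert_succ_eq hi, midpoint_hexCenter_oppFace, ← hw.rv_eq hi,
    show hw.sideIdx i + 2 = hw.sideIdx i + 2 from rfl, ← hw.lv_eq hi, midpoint_comm, mul_midpoint]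
  rfl

include hδ

/-- **Two distinct pieces of an interface loop meet only at an endpoint of each** (distinct
darts of a cycle have distinct edges; `polyPiece_inter_of_getVert`). [folklore] -/
theorem IsSiteInterfaceLoop.eq_polyPt_of_mem_polyPiece_of_ne {i j : ℕ} (hi : i < w.length) (hj : j < w.length)
    (hij : i ≠ j) {z : ℂ} (hzi : z ∈ polyPiece δ w i) (hzj : z ∈ polyPiece δ w j) :
    z = polyPt δ w i ∨ z = polyPt δ w (i + 1) := by
  have hinj := getVert_inj_of_isCycle hw.isCycle
  have h3 := hw.isCycle.three_le_length
  rcases Nat.lt_or_gt_of_ne hij with h | h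
  · rcases polyPiece_inter_of_getVert hδ.ne' h3 hinj h hj hzi hzj with ⟨-, hz⟩ | ⟨hi0, -, hz⟩
    · exact Or.inr hz
    · subst hi0; exact Or.inl hz
  · rcases polyPiece_inter_of_getVert hδ.ne' h3 hinj h hi hzj hzi with ⟨hi', hz⟩ | ⟨-, hin, hz⟩
    · subst hi'; exact Or.inl hz
    · right
      rw [hz, hin, polyPt_length_eq_polyPt_zero]

/-- **The side segment meets the trace only at the midpoint**: other pieces miss it
(`polyPiece_disjoint_sideSeg`) and the own piece meets it at the midpoint
(`eq_midpoint_of_mem_polyPiece_of_mem_sideSeg`). [folklore] -/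
theorem IsSiteInterfaceLoop.eq_midpoint_of_mem_sideSeg_of_mem_polyTrace {i : ℕ} (hi : i < w.length) {z : ℂ}
    (hz1 : z ∈ hw.sideSeg δ i) (hz2 : z ∈ polyTrace δ w) :
    z = midpoint ℝ (polyPt δ w i) (polyPt δ w (i + 1)) := by
  obtain ⟨j, hj, hzj⟩ := mem_polyTrace_iff.1 hz2
  by_cases hji : j = i
  · subst hji
    rw [polyPt, polyPt, ← mul_midpoint]
    exact hw.eq_midpoint_of_mem_polyPiece_of_mem_sideSeg hδ hj hzj hz1
  · exact absurd hz1 (disjoint_left.1 (hw.polyPiece_disjoint_sideSeg hδ hj hi hji) hzj)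

/-- The left point is not the midpoint of the side segment (the side segment has length `δ`). [folklore] -/
theorem IsSiteInterfaceLoop.leftPt_ne_midpoint {i : ℕ} (hi : i < w.length) :
    hw.leftPt δ i ≠ midpoint ℝ (hw.leftPt δ i) (hw.rightPt δ i) := by
  intro h
  have h1 := hw.dist_leftPt_rightPt hδ.le hi
  have h2 := dist_left_midpoint (𝕜 := ℝ) (hw.leftPt δ i) (hw.rightPt δ i)
  rw [← h, dist_self, h1] at h2
  have : (0 : ℝ) < ‖(2 : ℝ)‖⁻¹ * δ := by rw [Real.norm_two]; positivity
  linarith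

/-- **The two half side segments lie in the components of the left and of the right site**: for
`0 < s ≤ 1` the left site lies in the connected component, in the complement of the trace, of
the point `M + s (leftPt - M)` of the left half, and the right site in that of
`M + s (rightPt - M)` (`M` the midpoint; the half side segments minus `M` are off the trace and
convex). [folklore] -/
theorem IsSiteInterfaceLoop.mem_connectedComponentIn_midpoint_add_smul {i : ℕ} (hi : i < w.length) {s : ℝ}
    (hs0 : 0 < s) (hs1 : s ≤ 1) :
    hw.leftPt δ i ∈ connectedComponentIn (polyTrace δ w)ᶜ
        (midpoint ℝ (hw.leftPt δ i) (hw.rightPt δ i) + (s : ℂ) * (hw.leftPt δ i - midpoint ℝ (hw.leftPt δ i) (hw.rightPt δ i))) ∧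
      hw.rightPt δ i ∈ connectedComponentIn (polyTrace δ w)ᶜ
        (midpoint ℝ (hw.leftPt δ i) (hw.rightPt δ i) + (s : ℂ) * (hw.rightPt δ i - midpoint ℝ (hw.leftPt δ i) (hw.rightPt δ i))) := by
  set M := midpoint ℝ (hw.leftPt δ i) (hw.rightPt δ i) with hM
  have hMseg : M = midpoint ℝ (polyPt δ w i) (polyPt δ w (i + 1)) := (hw.midpoint_polyPt_eq hi).symm
  -- a segment from `M + s (P - M)` to `P`, `P` an endpoint of the side segment, misses the trace
  have key : ∀ P : ℂ, P ≠ M → segment ℝ M P ⊆ hw.sideSeg δ i →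
      P ∈ connectedComponentIn (polyTrace δ w)ᶜ (M + (s : ℂ) * (P - M)) := by
    intro P hPM hsub
    have hz : M + (s : ℂ) * (P - M) ∈ segment ℝ M P := by
      rw [segment_eq_image_lineMap]
      exact ⟨s, ⟨hs0.le, hs1⟩, by rw [AffineMap.lineMap_apply_module', Complex.real_smul]; ring⟩
    have hseg : segment ℝ (M + (s : ℂ) * (P - M)) P ⊆ (polyTrace δ w)ᶜ := by
      intro z hz' hzt
      have hz'' : z ∈ segment ℝ M P := (convex_segment _ _).segment_subset hz (right_mem_segment _ _ _) hz'
      have hzM : z = M := by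
        rw [hMseg]; exact hw.eq_midpoint_of_mem_sideSeg_of_mem_polyTrace hδ hi (hsub hz'') hzt
      -- but `M` is not on the segment from `M + s (P - M)` to `P` (`s > 0`)
      rw [segment_eq_image_lineMap] at hz'
      obtain ⟨t, ⟨ht0, ht1⟩, rfl⟩ := hz'
      rw [AffineMap.lineMap_apply_module'] at hzM
      have h0 : ((1 - t) * s + t : ℝ) • (P - M) = 0 := by
        have : (t : ℝ) • (P - (M + (s : ℂ) * (P - M))) + (M + (s : ℂ) * (P - M)) - M = 0 := by rw [hzM, sub_self]
        rw [← this]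
        simp only [Complex.real_smul]
        push_cast
        ring
      rcases smul_eq_zero.1 h0 with h | h
      · nlinarith
      · exact (hPM (sub_eq_zero.1 h)).elim
    exact (convex_segment _ _).isPreconnected.subset_connectedComponentIn (left_mem_segment _ _ _) hseg
      (right_mem_segment _ _ _)
  constructor
  · refine key _ (hw.leftPt_ne_midpoint hδ hi) ?_
    rw [IsSiteInterfaceLoop.sideSeg]
    exact (convex_segment _ _).segment_subset (midpoint_mem_segment _ _) (left_mem_segment _ _ _)
  · refine key _ ?_ ?_
    · intro h
      have h2 : (2 : ℂ) * M = hw.leftPt δ i + hw.rightPt δ i := by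
        rw [hM, midpoint_eq_smul_add, invOf_eq_inv, Complex.real_smul]
        push_cast
        ring
      exact hw.leftPt_ne_midpoint hδ hi (by rw [← hM]; linear_combination (-1 : ℂ) * h2 - h)
    · rw [IsSiteInterfaceLoop.sideSeg]
      exact (convex_segment _ _).segment_subset (midpoint_mem_segment _ _) (right_mem_segment _ _ _)

/-- **The two half side segments carry the winding numbers of the left and of the right site**:
for `0 < s ≤ 1` the point `M + s (leftPt - M)` of the left half winds like the left site and
`M + s (rightPt - M)` like the right site. [folklore] -/
theorem IsSiteInterfaceLoop.loopWind_midpoint_add_smul {i : ℕ} (hi : i < w.length) {s : ℝ} (hs0 : 0 < s) (hs1 : s ≤ 1) :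
    loopWind δ w (midpoint ℝ (hw.leftPt δ i) (hw.rightPt δ i) + (s : ℂ) * (hw.leftPt δ i - midpoint ℝ (hw.leftPt δ i) (hw.rightPt δ i))) =
        loopWind δ w (hw.leftPt δ i) ∧
      loopWind δ w (midpoint ℝ (hw.leftPt δ i) (hw.rightPt δ i) + (s : ℂ) * (hw.rightPt δ i - midpoint ℝ (hw.leftPt δ i) (hw.rightPt δ i))) =
        loopWind δ w (hw.rightPt δ i) := by
  have hlen : 0 < w.length := by omega
  obtain ⟨h1, h2⟩ := hw.mem_connectedComponentIn_midpoint_add_smul hδ hi hs0 hs1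
  exact ⟨loopWind_eq_of_mem_connectedComponentIn hlen h1, loopWind_eq_of_mem_connectedComponentIn hlen h2⟩

end Pieces

/-! ### The winding number at an arbitrary point off the trace -/

section AllPoints

variable {ω : SiteConfig (Site 2)} {f₀ : HexVertex} {w : hexGraph.Walk f₀ f₀}
  (hw : IsSiteInterfaceLoop ω w) {δ : ℝ} (hδ : 0 < δ)

include hw hδ

omit hw in
/-- **A generic direction from `p`**: a slope `m` such that the ray from `p` in the direction
`1 + m i` passes through no vertex of the polygon and is parallel to no piece (finitely many
slopes to avoid). [folklore] -/
theorem exists_good_slope (w : hexGraph.Walk f₀ f₀) (p : ℂ) :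
    ∃ m : ℝ, (∀ j ≤ w.length, ∀ t : ℝ, 0 < t → p + (t : ℂ) * (1 + (m : ℂ) * I) ≠ polyPt δ w j) ∧
      ∀ i < w.length, ∀ s : ℝ, polyPt δ w (i + 1) - polyPt δ w i ≠ (s : ℂ) * (1 + (m : ℂ) * I) := by
  classical
  set bad : Finset ℝ := ((Finset.range (w.length + 1)).image fun j ↦ (polyPt δ w j - p).im / (polyPt δ w j - p).re) ∪
    ((Finset.range w.length).image fun i ↦ (polyPt δ w (i + 1) - polyPt δ w i).im / (polyPt δ w (i + 1) - polyPt δ w i).re)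
    with hbad
  obtain ⟨m, hm⟩ := Infinite.exists_notMem_finset bad
  refine ⟨m, fun j hj t ht h ↦ hm ?_, fun i hi s h ↦ hm ?_⟩
  · have hv : polyPt δ w j - p = (t : ℂ) * (1 + (m : ℂ) * I) := by rw [← h]; ring
    have hre : (polyPt δ w j - p).re = t := by rw [hv]; simp
    have him : (polyPt δ w j - p).im = t * m := by rw [hv]; simp
    rw [hbad, Finset.mem_union]
    left
    refine Finset.mem_image.2 ⟨j, Finset.mem_range.2 (by omega), ?_⟩
    rw [hre, him, mul_div_cancel_left₀ _ ht.ne']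
  · have hs : s ≠ 0 := by
      rintro rfl
      rw [Complex.ofReal_zero, zero_mul, sub_eq_zero] at h
      exact polyPt_ne_polyPt_succ hδ.ne' hi h.symm
    have hre : (polyPt δ w (i + 1) - polyPt δ w i).re = s := by rw [h]; simp
    have him : (polyPt δ w (i + 1) - polyPt δ w i).im = s * m := by rw [h]; simp
    rw [hbad, Finset.mem_union]
    right
    refine Finset.mem_image.2 ⟨i, Finset.mem_range.2 hi, ?_⟩
    rw [hre, him, mul_div_cancel_left₀ _ hs]

/-- **Every point off the trace of an interface loop is connected, off the trace, to some lattice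
site.** Follow a generic ray from `p`: either it never meets the trace — then `p` is joined off
the trace to points beyond the disc containing the trace, and from there to the nearest site —
or it first meets the trace at an interior point `q` of some piece, from a definite side; near
`q` the trace is the straight piece alone (other pieces keep a positive distance from a compact
sub-segment through `q` and the midpoint `M`), so the open side regions are convex and
trace-free, and each contains the germ at `M` of one half of the side segment — the crossed
edge of `δ𝕋`, off the trace except at `M` — whose far end is the left (open) or the right
(closed) site of that step. Consequently every function that is constant on connected subsets
of the complement of the trace (winding numbers of any parametrisation of the polygon) takes at
`p` its value at some site. [folklore] -/
theorem IsSiteInterfaceLoop.exists_site_mem_connectedComponentIn {p : ℂ} (hp : p ∉ polyTrace δ w) :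
    ∃ a : Site 2, triMeshPoint δ a ∈ connectedComponentIn (polyTrace δ w)ᶜ p := by
  have h3 := hw.isCycle.three_le_length
  have hlen : 0 < w.length := by omega
  obtain ⟨m, hmv, hmd⟩ := exists_good_slope hδ w p
  set u : ℂ := 1 + (m : ℂ) * I with hu
  have hu1 : 1 ≤ ‖u‖ := by
    have : (1 : ℝ) ≤ ‖u‖ ^ 2 := by
      rw [hu, Complex.sq_norm, Complex.normSq_apply]; simp; nlinarith
    nlinarith [norm_nonneg u]
  have hu0 : u ≠ 0 := fun h ↦ by rw [h, norm_zero] at hu1; linarith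
  -- the ray and its trace-free initial stretches
  set r : ℝ → ℂ := fun t ↦ p + (t : ℂ) * u with hr
  have hrc : Continuous r := by fun_prop
  have hray_comp : ∀ t : ℝ, 0 ≤ t → (∀ t' ∈ Icc 0 t, r t' ∉ polyTrace δ w) → r t ∈ connectedComponentIn (polyTrace δ w)ᶜ p := by
    intro t ht hfree
    have hseg : segment ℝ p (r t) ⊆ (polyTrace δ w)ᶜ := by
      rw [segment_eq_image_lineMap]
      rintro _ ⟨θ, ⟨hθ0, hθ1⟩, rfl⟩ hmem
      refine hfree (θ * t) ⟨mul_nonneg hθ0 ht, by nlinarith⟩ ?_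
      convert hmem using 1
      rw [AffineMap.lineMap_apply_module', hr]
      simp only [Complex.real_smul]
      push_cast; ring
    exact (convex_segment _ _).isPreconnected.subset_connectedComponentIn (left_mem_segment _ _ _) hseg
      (right_mem_segment _ _ _)
  -- the trace is bounded
  obtain ⟨ρ, hρ⟩ := exists_polyTrace_subset_closedBall hlen δ
  by_cases hhit : ∃ t : ℝ, 0 ≤ t ∧ r t ∈ polyTrace δ w
  swap
  · -- Case A: the ray never meets the trace: follow it beyond the trace and round to the nearest site
    push Not at hhit
    set T : ℝ := |ρ| + ‖p‖ + δ + 1 with hT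
    have hT0 : 0 ≤ T := by positivity
    have hfarT : |ρ| + δ + 1 ≤ ‖r T‖ := by
      rw [hr]
      simp only
      have h1 : ‖(T : ℂ) * u‖ ≥ T := by
        rw [norm_mul, Complex.norm_real, Real.norm_of_nonneg hT0]
        nlinarith
      have h2 := norm_sub_norm_le ((T : ℂ) * u) (-p)
      rw [sub_neg_eq_add, norm_neg, add_comm] at h2
      linarith
    obtain ⟨a, ha⟩ := exists_dist_triMeshPoint_le hδ (r T)
    refine ⟨a, ?_⟩
    -- the short segment from `r T` to the site `a` stays outside the disc containing the trace
    have hcomp := hray_comp T hT0 fun t' ht' ↦ hhit t' ht'.1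
    rw [connectedComponentIn_eq hcomp]
    have hseg : segment ℝ (r T) (triMeshPoint δ a) ⊆ (polyTrace δ w)ᶜ := by
      intro z hz hzt
      have hzρ : ‖z‖ ≤ ρ := by simpa [mem_closedBall, dist_zero_right] using hρ hzt
      have hzd : dist z (r T) ≤ dist (r T) (triMeshPoint δ a) := by
        rw [segment_eq_image_lineMap] at hz
        obtain ⟨θ, ⟨hθ0, hθ1⟩, rfl⟩ := hz
        rw [dist_comm, dist_left_lineMap, Real.norm_of_nonneg hθ0]
        exact mul_le_of_le_one_left dist_nonneg hθ1
      have h3 := norm_sub_norm_le (r T) z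
      rw [← dist_eq_norm, dist_comm] at h3
      linarith [le_abs_self ρ]
    exact (convex_segment _ _).isPreconnected.subset_connectedComponentIn (left_mem_segment _ _ _) hseg
      (right_mem_segment _ _ _)
  -- Case B: first hitting time
  set Tset : Set ℝ := {t | 0 ≤ t ∧ r t ∈ polyTrace δ w} with hTset
  have hTne : Tset.Nonempty := hhit
  have hTbdd : BddBelow Tset := ⟨0, fun t ht ↦ ht.1⟩
  have hTclosed : IsClosed Tset := (isClosed_Ici.inter ((isClosed_polyTrace δ w).preimage hrc) :)
  set t₀ := sInf Tset with ht₀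
  have ht₀mem : t₀ ∈ Tset := hTclosed.csInf_mem hTne hTbdd
  have ht₀0 : 0 ≤ t₀ := ht₀mem.1
  have hq : r t₀ ∈ polyTrace δ w := ht₀mem.2
  have hfree : ∀ t' ∈ Ico 0 t₀, r t' ∉ polyTrace δ w := fun t' ht' h ↦
    absurd (csInf_le hTbdd ⟨ht'.1, h⟩) (not_le.2 ht'.2)
  have ht₀pos : 0 < t₀ := by
    rcases ht₀0.eq_or_lt with h | h
    · exfalso; apply hp; rw [← h] at hq; simpa [hr] using hq
    · exact h
  set q := r t₀ with hqdef
  obtain ⟨i, hi, hqi⟩ := mem_polyTrace_iff.1 hq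
  set A := polyPt δ w i with hA
  set B := polyPt δ w (i + 1) with hB
  have hAB : A ≠ B := polyPt_ne_polyPt_succ hδ.ne' hi
  -- `q` is not a vertex
  have hqA : q ≠ A := hmv i hi.le t₀ ht₀pos
  have hqB : q ≠ B := hmv (i + 1) hi t₀ ht₀pos
  -- parameter of `q` on the piece
  have hqi' := hqi
  rw [polyPiece, segment_eq_image_lineMap] at hqi'
  obtain ⟨θ, ⟨hθ0, hθ1⟩, hθq⟩ := hqi'
  have hθ0' : 0 < θ := by
    rcases hθ0.eq_or_lt with rfl | h
    · exact absurd (by rw [← hθq, AffineMap.lineMap_apply_zero]) hqA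
    · exact h
  have hθ1' : θ < 1 := by
    rcases hθ1.eq_or_lt' with rfl | h
    · exact absurd (by rw [← hθq, AffineMap.lineMap_apply_one]) hqB
    · exact h
  -- the compact sub-segment `K` through `q` and the midpoint
  have hlm : ∀ lam : ℝ, (AffineMap.lineMap A B lam : ℂ) = A + (lam : ℂ) * (B - A) := fun lam ↦ by
    rw [AffineMap.lineMap_apply_module', Complex.real_smul]; ring
  set s₁ : ℝ := min θ 2⁻¹ / 2 with hs₁
  set s₂ : ℝ := (max θ 2⁻¹ + 1) / 2 with hs₂
  have hs₁0 : 0 < s₁ := by rw [hs₁]; exact half_pos (lt_min hθ0' (by norm_num))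
  have hs₂1 : s₂ < 1 := by
    rw [hs₂]; have : max θ 2⁻¹ < 1 := max_lt hθ1' (by norm_num); linarith
  have hs₁θ : s₁ ≤ θ := by rw [hs₁]; have := min_le_left θ 2⁻¹; linarith
  have hθs₂ : θ ≤ s₂ := by rw [hs₂]; have := le_max_left θ 2⁻¹; linarith
  have hs₁h : s₁ ≤ 2⁻¹ := by rw [hs₁]; have := min_le_right θ 2⁻¹; linarith [hθ0]
  have hhs₂ : (2⁻¹ : ℝ) ≤ s₂ := by rw [hs₂]; have := le_max_right θ 2⁻¹; linarith
  set K : Set ℂ := (AffineMap.lineMap A B : ℝ → ℂ) '' Icc s₁ s₂ with hK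
  have hKcont : Continuous fun lam : ℝ ↦ (AffineMap.lineMap A B lam : ℂ) := by
    simp only [hlm]; fun_prop
  have hKc : IsCompact K := isCompact_Icc.image hKcont
  have hKconv : Convex ℝ K := (convex_Icc s₁ s₂).affine_image (AffineMap.lineMap A B)
  have hKpiece : K ⊆ polyPiece δ w i := by
    rintro _ ⟨lam, ⟨h1, h2⟩, rfl⟩
    rw [polyPiece, segment_eq_image_lineMap]
    exact ⟨lam, ⟨by linarith, by linarith⟩, rfl⟩
  have hKends : ∀ z ∈ K, z ≠ A ∧ z ≠ B := by
    rintro _ ⟨lam, ⟨h1, h2⟩, rfl⟩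
    have hBA : B - A ≠ 0 := sub_ne_zero.2 hAB.symm
    rw [hlm]
    constructor
    · intro h
      have : (lam : ℂ) * (B - A) = 0 := by linear_combination h
      rcases mul_eq_zero.1 this with h' | h'
      · have : lam = 0 := by exact_mod_cast h'
        linarith
      · exact hBA h'
    · intro h
      have : ((lam : ℂ) - 1) * (B - A) = 0 := by linear_combination h
      rcases mul_eq_zero.1 this with h' | h'
      · have : lam = 1 := by exact_mod_cast sub_eq_zero.1 h'
        linarith
      · exact hBA h'
  have hqK : q ∈ K := ⟨θ, ⟨hs₁θ, hθs₂⟩, hθq⟩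
  set M : ℂ := midpoint ℝ A B with hMdef
  have hMK : M ∈ K := ⟨2⁻¹, ⟨hs₁h, hhs₂⟩, by rw [hMdef, midpoint, invOf_eq_inv]⟩
  have hM0 : segSide A B M = 0 := segSide_eq_zero_of_mem_segment (midpoint_mem_segment _ _)
  -- the other pieces keep a positive distance from `K`
  set U : Set ℂ := (⋃ j ∈ (Finset.range w.length).filter (· ≠ i), polyPiece δ w j)ᶜ with hU
  have hUo : IsOpen U := by
    rw [hU, isOpen_compl_iff]
    refine Set.Finite.isClosed_biUnion (Finset.finite_toSet _) fun j _ ↦ ?_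
    rw [polyPiece, ← Path.range_segment]
    exact (isCompact_range (Path.segment _ _).continuous).isClosed
  have hKU : K ⊆ U := by
    intro z hz
    rw [hU, mem_compl_iff]
    intro hz'
    obtain ⟨j, hj, hzj⟩ := mem_iUnion₂.1 hz'
    rw [Finset.mem_filter, Finset.mem_range] at hj
    rcases hw.eq_polyPt_of_mem_polyPiece_of_ne hδ hi hj.1 (Ne.symm hj.2) (hKpiece hz) hzj with h | h
    · exact (hKends z hz).1 h
    · exact (hKends z hz).2 h
  obtain ⟨ρ', hρ'0, hρ'U⟩ := hKc.exists_thickening_subset_open hUo hKU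
  -- near `K`, off the line, there is no trace
  have hVfree : ∀ z ∈ thickening ρ' K, segSide A B z ≠ 0 → z ∉ polyTrace δ w := by
    intro z hz hside hzt
    obtain ⟨j, hj, hzj⟩ := mem_polyTrace_iff.1 hzt
    by_cases hji : j = i
    · subst hji; exact hside (segSide_eq_zero_of_mem_segment hzj)
    · exact hρ'U hz (mem_iUnion₂.2 ⟨j, by
        rw [Finset.mem_filter, Finset.mem_range]; exact ⟨hj, hji⟩, hzj⟩)
  -- the winding number is constant on each open side near `K`
  have hVcomp : ∀ S : Set ℂ, Convex ℝ S → S ⊆ thickening ρ' K → (∀ z ∈ S, segSide A B z ≠ 0) →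
      ∀ z ∈ S, ∀ z' ∈ S, z' ∈ connectedComponentIn (polyTrace δ w)ᶜ z := by
    intro S hS hSt hSs z hz z' hz'
    exact hS.isPreconnected.subset_connectedComponentIn hz (fun y hy ↦ hVfree y (hSt hy) (hSs y hy)) hz'
  have hVp : Convex ℝ (thickening ρ' K ∩ {z | 0 < segSide A B z}) :=
    (hKconv.thickening ρ').inter (convex_setOf_segSide_pos A B)
  have hVn : Convex ℝ (thickening ρ' K ∩ {z | segSide A B z < 0}) :=
    (hKconv.thickening ρ').inter (convex_setOf_segSide_neg A B)
  -- the direction is transverse to the piece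
  set cu : ℝ := (B - A).im * u.re - (B - A).re * u.im with hcudef
  have hcu : cu ≠ 0 := by
    intro h0
    have hre : u.re = 1 := by rw [hu]; simp
    have him : u.im = m := by rw [hu]; simp
    refine hmd i hi (B - A).re (Complex.ext ?_ ?_)
    · simp [Complex.mul_re, hre, him, hA, hB]
    · simp only [Complex.mul_im, Complex.ofReal_re, Complex.ofReal_im, zero_mul, add_zero, hre, him]
      rw [hcudef, hre, him] at h0
      linarith
  -- the approaching point `q' = q - ε u`
  have hupos : 0 < ‖u‖ := by linarith
  set ε : ℝ := min (t₀ / 2) (ρ' / (2 * ‖u‖)) with hεdef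
  have hε0 : 0 < ε := lt_min (by linarith) (by positivity)
  have hεt : ε < t₀ := (min_le_left _ _).trans_lt (by linarith)
  have hεu : ε * ‖u‖ < ρ' := by
    calc ε * ‖u‖ ≤ ρ' / (2 * ‖u‖) * ‖u‖ := by gcongr; exact min_le_right _ _
      _ = ρ' / 2 := by field_simp
      _ < ρ' := by linarith
  set q' : ℂ := r (t₀ - ε) with hq'def
  have hq'eq : q' = q + ((-ε : ℝ) : ℂ) * u := by
    simp only [hq'def, hqdef, hr]; push_cast; ring
  have hpq' : q' ∈ connectedComponentIn (polyTrace δ w)ᶜ p :=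
    hray_comp (t₀ - ε) (by linarith) fun t' ht' ↦ hfree t' ⟨ht'.1, by linarith [ht'.2]⟩
  have hq'th : q' ∈ thickening ρ' K := by
    refine mem_thickening_iff.2 ⟨q, hqK, ?_⟩
    rw [hq'eq, dist_eq_norm, add_sub_cancel_left, norm_mul, Complex.norm_real, Real.norm_eq_abs, abs_neg,
      abs_of_pos hε0]
    exact hεu
  have hq0 : segSide A B q = 0 := segSide_eq_zero_of_mem_segment hqi
  have hq'side : segSide A B q' = (-ε) * cu := by rw [hq'eq, segSide_add_smul hq0]
  have hq'ne : segSide A B q' ≠ 0 := by rw [hq'side]; exact mul_ne_zero (by linarith) hcu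
  -- the side segment of the step: endpoints `PL`, `PR`, midpoint `M`
  set PL := hw.leftPt δ i with hPL
  set PR := hw.rightPt δ i with hPR
  have hMM : M = midpoint ℝ PL PR := hw.midpoint_polyPt_eq hi
  have h2M : (2 : ℂ) * M = PL + PR := by
    rw [hMM, midpoint_eq_smul_add, invOf_eq_inv, Complex.real_smul]; push_cast; ring
  have hPRM : PR - M = -(PL - M) := by linear_combination (-1 : ℂ) * h2M
  have hPLM : PL ≠ M := fun h ↦ hw.leftPt_ne_midpoint hδ hi (h.trans hMM)
  have hnormPL : 0 < ‖PL - M‖ := norm_pos_iff.2 (sub_ne_zero.2 hPLM)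
  -- the points `M + s (P - M)`, `P = PL, PR`, `0 < s ≤ 1`, are off the trace
  have hzoff : ∀ P : ℂ, (P = PL ∨ P = PR) → ∀ s : ℝ, 0 < s → s ≤ 1 → M + (s : ℂ) * (P - M) ∉ polyTrace δ w := by
    intro P hP s hs0 hs1 hmem
    have hMside : M ∈ hw.sideSeg δ i := by
      rw [hMM, IsSiteInterfaceLoop.sideSeg]; exact midpoint_mem_segment _ _
    have h1 : M + (s : ℂ) * (P - M) ∈ segment ℝ M P := by
      rw [segment_eq_image_lineMap]
      exact ⟨s, ⟨hs0.le, hs1⟩, by rw [AffineMap.lineMap_apply_module', Complex.real_smul]; ring⟩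
    have hseg : M + (s : ℂ) * (P - M) ∈ hw.sideSeg δ i := by
      have hconv : Convex ℝ (hw.sideSeg δ i) := by rw [IsSiteInterfaceLoop.sideSeg]; exact convex_segment _ _
      rcases hP with rfl | rfl
      · exact hconv.segment_subset hMside (by rw [IsSiteInterfaceLoop.sideSeg]; exact left_mem_segment _ _ _) h1
      · exact hconv.segment_subset hMside (by rw [IsSiteInterfaceLoop.sideSeg]; exact right_mem_segment _ _ _) h1
    have heq := hw.eq_midpoint_of_mem_sideSeg_of_mem_polyTrace hδ hi hseg hmem
    have hsP : (s : ℂ) * (P - M) = 0 := by rw [← hMdef] at heq; linear_combination heq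
    rcases mul_eq_zero.1 hsP with h | h
    · exact hs0.ne' (by exact_mod_cast h)
    · rcases hP with rfl | rfl
      · exact hPLM (sub_eq_zero.1 h)
      · exact hPLM (sub_eq_zero.1 (by linear_combination hPRM - h))
  -- the side segment is transverse to the piece
  set cL : ℝ := (B - A).im * (PL - M).re - (B - A).re * (PL - M).im with hcLdef
  have hsideL : ∀ s : ℝ, segSide A B (M + (s : ℂ) * (PL - M)) = s * cL := fun s ↦ by
    rw [segSide_add_smul hM0]
  have hsideR : ∀ s : ℝ, segSide A B (M + (s : ℂ) * (PR - M)) = -(s * cL) := fun s ↦ by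
    rw [segSide_add_smul hM0, hPRM]
    simp only [Complex.neg_re, Complex.neg_im]
    rw [hcLdef]; ring
  have hdistP : ∀ P : ℂ, (P = PL ∨ P = PR) → ∀ s : ℝ, 0 < s → dist (M + (s : ℂ) * (P - M)) M = s * ‖PL - M‖ := by
    intro P hP s hs
    rw [dist_eq_norm, add_sub_cancel_left, norm_mul, Complex.norm_real, Real.norm_of_nonneg hs.le]
    rcases hP with rfl | rfl
    · rfl
    · rw [hPRM, norm_neg]
  have hcL : cL ≠ 0 := by
    intro h0
    set s : ℝ := min 1 (dist A B / (4 * ‖PL - M‖)) with hsdef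
    have hs0 : 0 < s := lt_min one_pos (div_pos (dist_pos.2 hAB) (by positivity))
    have hs1 : s ≤ 1 := min_le_left _ _
    refine hzoff PL (Or.inl rfl) s hs0 hs1 (polyPiece_subset_polyTrace hi ?_)
    refine mem_segment_of_segSide_eq_zero_of_dist_midpoint_lt hAB (by rw [hsideL, h0, mul_zero]) ?_
    rw [← hMdef, hdistP PL (Or.inl rfl) s hs0]
    calc s * ‖PL - M‖ ≤ dist A B / (4 * ‖PL - M‖) * ‖PL - M‖ := by gcongr; exact min_le_right _ _
      _ = dist A B / 4 := by field_simp
      _ < dist A B / 2 := by linarith [dist_pos.2 hAB]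
  -- the two side points near `M`
  set s : ℝ := min 1 (ρ' / (2 * ‖PL - M‖)) with hsdef
  have hs0 : 0 < s := lt_min one_pos (by positivity)
  have hs1 : s ≤ 1 := min_le_left _ _
  have hsρ : s * ‖PL - M‖ < ρ' := by
    calc s * ‖PL - M‖ ≤ ρ' / (2 * ‖PL - M‖) * ‖PL - M‖ := by gcongr; exact min_le_right _ _
      _ = ρ' / 2 := by field_simp
      _ < ρ' := by linarith
  set zL : ℂ := M + (s : ℂ) * (PL - M) with hzLdef
  set zR : ℂ := M + (s : ℂ) * (PR - M) with hzRdef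
  have hzLth : zL ∈ thickening ρ' K := mem_thickening_iff.2 ⟨M, hMK, by rw [hzLdef, hdistP PL (Or.inl rfl) s hs0]; exact hsρ⟩
  have hzRth : zR ∈ thickening ρ' K := mem_thickening_iff.2 ⟨M, hMK, by rw [hzRdef, hdistP PR (Or.inr rfl) s hs0]; exact hsρ⟩
  have hwind := hw.mem_connectedComponentIn_midpoint_add_smul hδ hi hs0 hs1
  rw [← hPL, ← hPR, ← hMM] at hwind
  obtain ⟨hzLw, hzRw⟩ := hwind
  have hsL : segSide A B zL = s * cL := hsideL s
  have hsR : segSide A B zR = -(s * cL) := hsideR s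
  have hscL : s * cL ≠ 0 := mul_ne_zero hs0.ne' hcL
  -- conclusion: `q'` shares an open side region with `zL` or with `zR`
  have hfinal : PL ∈ connectedComponentIn (polyTrace δ w)ᶜ q' ∨ PR ∈ connectedComponentIn (polyTrace δ w)ᶜ q' := by
    rcases lt_or_gt_of_ne hq'ne with hneg | hpos
    · rcases lt_or_gt_of_ne hscL with hL | hL
      · left
        have h := hVcomp _ hVn inter_subset_left (fun z hz ↦ (ne_of_lt hz.2)) q' ⟨hq'th, hneg⟩ zL
          ⟨hzLth, by rw [mem_setOf_eq, hsL]; exact hL⟩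
        rw [connectedComponentIn_eq h]; exact hzLw
      · right
        have h := hVcomp _ hVn inter_subset_left (fun z hz ↦ (ne_of_lt hz.2)) q' ⟨hq'th, hneg⟩ zR
          ⟨hzRth, by rw [mem_setOf_eq, hsR]; linarith⟩
        rw [connectedComponentIn_eq h]; exact hzRw
    · rcases lt_or_gt_of_ne hscL with hL | hL
      · right
        have h := hVcomp _ hVp inter_subset_left (fun z hz ↦ (ne_of_gt hz.2)) q' ⟨hq'th, hpos⟩ zR
          ⟨hzRth, by rw [mem_setOf_eq, hsR]; linarith⟩
        rw [connectedComponentIn_eq h]; exact hzRw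
      · left
        have h := hVcomp _ hVp inter_subset_left (fun z hz ↦ (ne_of_gt hz.2)) q' ⟨hq'th, hpos⟩ zL
          ⟨hzLth, by rw [mem_setOf_eq, hsL]; exact hL⟩
        rw [connectedComponentIn_eq h]; exact hzLw
  rw [connectedComponentIn_eq hpq']
  rcases hfinal with h | h
  · exact ⟨hw.lv i, h⟩
  · exact ⟨hw.rv i, h⟩

/-- **The winding number of an interface loop at any point off its trace is its winding number
at some lattice site** (`exists_site_mem_connectedComponentIn`: the winding number is constant
on connected subsets of the complement of the trace). [folklore] -/
theorem IsSiteInterfaceLoop.exists_site_loopWind_eq {p : ℂ} (hp : p ∉ polyTrace δ w) :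
    ∃ a : Site 2, loopWind δ w p = loopWind δ w (triMeshPoint δ a) := by
  have hlen : 0 < w.length := by have := hw.isCycle.three_le_length; omega
  obtain ⟨a, ha⟩ := hw.exists_site_mem_connectedComponentIn hδ hp
  exact ⟨a, loopWind_eq_of_mem_connectedComponentIn hlen ha⟩

/-- **Winding numbers of interface loops are `-1`, `0` or `1` at every point off the trace.** [folklore] -/
theorem IsSiteInterfaceLoop.abs_loopWind_le_one_of_not_mem {p : ℂ} (hp : p ∉ polyTrace δ w) :
    |loopWind δ w p| ≤ 1 := by
  obtain ⟨a, ha⟩ := hw.exists_site_loopWind_eq hδ hp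
  rw [ha]
  exact hw.abs_loopWind_triMeshPoint_le_one hδ a

/-- **A loop of DKKMO type `1` (positive shoelace sum: anticlockwise) winds `0` or `1` about every
point off its trace** — its interior `{wind = 1}` contains the open sites along it, its exterior
`{wind = 0}` the closed ones (`SiteInterfaceWindingSigns.lean`). [folklore] -/
theorem IsSiteInterfaceLoop.loopWind_eq_zero_or_one_of_shoelace_pos_of_not_mem
    (h : 0 < shoelace (w.support.map hexCenter)) {p : ℂ} (hp : p ∉ polyTrace δ w) :
    loopWind δ w p = 0 ∨ loopWind δ w p = 1 := by
  obtain ⟨a, ha⟩ := hw.exists_site_loopWind_eq hδ hp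
  rw [ha]
  exact hw.loopWind_eq_zero_or_one_of_shoelace_pos hδ h a

/-- **A loop of DKKMO type `0` (non-positive shoelace sum: clockwise) winds `0` or `-1` about
every point off its trace.** [folklore] -/
theorem IsSiteInterfaceLoop.loopWind_eq_zero_or_neg_one_of_shoelace_nonpos_of_not_mem
    (h : shoelace (w.support.map hexCenter) ≤ 0) {p : ℂ} (hp : p ∉ polyTrace δ w) :
    loopWind δ w p = 0 ∨ loopWind δ w p = -1 := by
  obtain ⟨a, ha⟩ := hw.exists_site_loopWind_eq hδ hp
  rw [ha]
  exact hw.loopWind_eq_zero_or_neg_one_of_shoelace_nonpos hδ h a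

end AllPoints

end Literature.Probability.Percolation

end
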